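import Literature.MathematicalPhysics.QuantumLattice.DWaveKomaTasakiSystemTTPrime
import Literature.MathematicalPhysics.QuantumLattice.DWaveSourcePhaseRotation
import HarnessLib

/-!
# The pair-sourced `t–t'` Hubbard torus IS a Koma–Tasaki `ℤ₂` system: thermal pair long-range order forces the
# sourced thermal pair amplitude at EVERY `t'` (KT93 Thm 2.1 by name; the `T > 0` column at the second anchor)

Topic `Literature/MathematicalPhysics/QuantumLattice` (namespace = path; family `hubbard`). The `t' ≠ 0` TWIN of
`DWaveKomaTasakiThermal.lean` (hubbard-cq-p4 g2), built on the `3 × 3`-block local terms `localHamTT'` of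
`DWaveKomaTasakiSystemTTPrime.lean` — the one previously EMPTY cell (`T > 0` × `t' ≠ 0`) of the Koma–Tasaki
dictionary of the Hubbard cuprate cell (`hubbard-cq`, KLS-KT-DICTIONARY v6). `H_Λ = hubbardTorusTT' L 1 t' U − μN`,
`O_Λ = Δ_g + Δ_g†`, sign-flipping unitary `e^{i(π/2)N̂}`, `h̄ = 45(2+|U|+2|μ|)+18|t'|`, `ō = 2K_g`, `r = 45`.

* `dWaveZ2SystemTT' L t' U μ g` + dictionary (`_hamiltonian`, `_order`, `_fieldHamiltonian[_dWave]`
  (`= dWaveSourceTorusTT' L t' U μ B`), `_magnetisation_dWave`, `_moment_dWave`, `_freeEnergy_dWave`);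
* **`dWave_kt93_theorem_2_1_TT'`** (KT93 Thm 2.1 for the systems `dWaveZ2SystemTT' (L+1) t' U μ g` under KT's
  hypothesis i)), **`dWave_thermal_pairLRO_le_sourcedPairAmplitude_TT'`** (torus vocabulary: eventually
  `√(((L'+1)²)⁻² Re⟨(Δ_d+Δ_d†)²⟩_{β,0}) ≤ ((L+1)²)⁻¹ Re⟨Δ_d+Δ_d†⟩_{β,B} + ε`), the sourced-pressure-limit forms
  `dWaveZ2SystemTT'_freeEnergy_tendsto_of_pressureLimit`, `dWave_thermal_pairLRO_le_sourcedPairAmplitude_TT'_of_pressureLimit`.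

* the `U(1)`-sharp forms with the factor `√2`: `dWave_kt93_corollary_2_2_u1_TT'`,
  `dWave_thermal_pairLRO_le_sourcedPairAmplitude_TT'_sqrtTwo[_of_pressureLimit]`.

HONEST SCOPE: `T > 0`, direction LRO ⇒ response only; hypothesis i) (sourced pressure limit) is an input; no
number, no instrument. Everything PROVED; one definition (the instance); zero compute.

## References
* T. Koma, H. Tasaki, Commun. Math. Phys. 158 (1993) 191–214, §2 (2.1)–(2.13), Thm 2.1. [cite: KomaTasaki1993, §2 Theorem 2.1]
* T. Koma, H. Tasaki, J. Stat. Phys. 76 (1994) 745–803, §3.3–3.4. [cite: KomaTasaki1994, §3.3–3.4]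
* H. Xu et al., Science 384 (2024) eadh7691, eq. (1). [cite: XuEtAl2024, eq. (1) p. 2]
-/

noncomputable section

open Matrix Complex Finset Filter Literature.Probability.LatticeModels
open scoped Matrix.Norms.L2Operator ComplexOrder Topology

namespace Literature.MathematicalPhysics.QuantumLattice

open DWaveKT DWaveKTNNN

attribute [local instance 10000] instDecidableEqFermionTorusKT

/-! ### The `ℤ₂` system of KT93 §2 for the pair field of the `t–t'` torus -/

section InstanceTT

variable (L : ℕ) [NeZero L] (t' U μ : ℝ) (g : Site 2 → ℝ)

/-- **THE PAIR-SOURCED `t–t'` HUBBARD TORUS AS A KOMA–TASAKI `ℤ₂` SYSTEM** (KT93 §2 data (2.1)–(2.5), ii),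
iii)): `N = |Λ_L|` sites (enumerated by `Fintype.equivFin`), `h_x =` the `t–t'` Hubbard terms anchored at `x`
(`DWaveKTNNN.localHamTT'`: nearest-neighbour terms on the plaquette of `x` plus the diagonal hoppings anchored
at `x`, all inside the `3 × 3` block of `x`; `Σ_x h_x = hubbardTorusTT' L 1 t' U − μN`), `o_x = P_x + P_x†`
(`DWaveKT.pairDensity 0`, `Σ_x o_x = Δ_g + Δ_g†`), the symmetry unitary `U_Λ = e^{i(π/2)N̂}` ((2.3)
`U H U* = H` by particle-number conservation, (2.5) `U O U* = −O` since `Δ_g` has charge `−2`), supports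
`S(x) =` the `≤ 45` sites whose 5-site plaquettes meet the block of `x` (graded locality of even operators),
`h̄ = 45(2+|U|+2|μ|)+18|t'|`, `ō = 2K_g`, `r = 45`.
[cite: KomaTasaki1993, §2 (2.1)–(2.9), ii), iii)] [cite: KomaTasaki1994, §3.3–3.4] -/
def dWaveZ2SystemTT' :
    KomaTasaki.Z2System (Fintype.card (TorusSite 2 L)) (45 * (2 + |U| + 2 * |μ|) + 18 * |t'|)
      (2 * pairNormConst g) 45 (FockIdx L) where
  h i := localHamTT' L t' U μ ((Fintype.equivFin (TorusSite 2 L)).symm i)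
  o i := pairDensity L g 0 ((Fintype.equivFin (TorusSite 2 L)).symm i)
  U := fockGaugeU1 (Real.pi / 2)
  supp i := (suppTT' L ((Fintype.equivFin (TorusSite 2 L)).symm i)).map
    (Fintype.equivFin (TorusSite 2 L)).toEmbedding
  isHermitian_h i := isHermitian_localHamTT' L t' U μ _
  isHermitian_o i := isHermitian_pairDensity L g 0 _
  U_mul_conjTranspose := fockGaugeU1_mul_conjTranspose_self _
  conj_hamiltonian := by
    rw [(Fintype.equivFin (TorusSite 2 L)).symm.sum_comp (fun y => localHamTT' L t' U μ y),
      sum_localHamTT'_eq_dWaveSourceTorusTT', ← gaugeAut_apply, gaugeAut_dWaveSourceTorusTT'_zero]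
  conj_order := by
    rw [(Fintype.equivFin (TorusSite 2 L)).symm.sum_comp (fun y => pairDensity L g 0 y), sum_pairDensity_zero,
      ← gaugeAut_apply, gaugeAut_pi_div_two_pairField_add]
  norm_h_le i := norm_localHamTT'_le L t' U μ _
  norm_o_le i := norm_pairDensity_le L g 0 _
  commute_h_o i j hj := by
    have hj' : (Fintype.equivFin (TorusSite 2 L)).symm j ∉
        suppTT' L ((Fintype.equivFin (TorusSite 2 L)).symm i) := by
      rwa [Finset.mem_map_equiv] at hj
    exact commute_of_mem_carEvenSubalgebra (localHamTT'_mem L t' U μ _)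
      ((carEvenSubalgebra_le_carSubalgebra _) (pairDensity_mem L g 0 _))
      (disjoint_orbSet (disjoint_block_plaq_of_not_mem L hj'))
  card_supp_le i := by
    rw [Finset.card_map]
    exact card_suppTT'_le L _
  two_le_r := by norm_num

/-- `H_Λ = hubbardTorusTT' L 1 t' U − μN`. [cite: KomaTasaki1993, §2 (2.2)] -/
theorem dWaveZ2SystemTT'_hamiltonian :
    (dWaveZ2SystemTT' L t' U μ g).hamiltonian = hubbardTorusTT' L 1 t' U - (μ : ℂ) • totalNumber := by
  rw [KomaTasaki.Z2System.hamiltonian]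
  change ∑ i, localHamTT' L t' U μ ((Fintype.equivFin (TorusSite 2 L)).symm i) = _
  rw [(Fintype.equivFin (TorusSite 2 L)).symm.sum_comp (fun y => localHamTT' L t' U μ y), sum_localHamTT']

/-- `O_Λ = Δ_g + Δ_g†`. [cite: KomaTasaki1993, §2 (2.4)] -/
theorem dWaveZ2SystemTT'_order : (dWaveZ2SystemTT' L t' U μ g).order = pairField g L + (pairField g L)ᴴ := by
  rw [KomaTasaki.Z2System.order]
  change ∑ i, pairDensity L g 0 ((Fintype.equivFin (TorusSite 2 L)).symm i) = _
  rw [(Fintype.equivFin (TorusSite 2 L)).symm.sum_comp (fun y => pairDensity L g 0 y), sum_pairDensity_zero]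

/-- `H_Λ(B) = hubbardTorusTT' L 1 t' U − μN − B(Δ_g + Δ_g†)`. [cite: KomaTasaki1993, §2 (2.6)] -/
theorem dWaveZ2SystemTT'_fieldHamiltonian (B : ℝ) :
    (dWaveZ2SystemTT' L t' U μ g).fieldHamiltonian B =
      hubbardTorusTT' L 1 t' U - (μ : ℂ) • totalNumber - (B : ℂ) • (pairField g L + (pairField g L)ᴴ) := by
  rw [KomaTasaki.Z2System.fieldHamiltonian, dWaveZ2SystemTT'_hamiltonian, dWaveZ2SystemTT'_order]

/-- For `g = dWaveFormFactor`: `H_Λ(B) = dWaveSourceTorusTT' L t' U μ B` (the pair-sourced `t–t'` torus).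
[cite: KomaTasaki1994, §1] -/
theorem dWaveZ2SystemTT'_fieldHamiltonian_dWave (B : ℝ) :
    (dWaveZ2SystemTT' L t' U μ dWaveFormFactor).fieldHamiltonian B = dWaveSourceTorusTT' L t' U μ B := by
  rw [dWaveZ2SystemTT'_fieldHamiltonian, dWaveSourceTorusTT'_eq_zero_sub_smul, dWaveSourceTorusTT'_zero_source]

/-- `H_Λ(0) = dWaveSourceTorusTT' L t' U μ 0` for the `d`-wave system. [cite: KomaTasaki1994, §1] -/
theorem dWaveZ2SystemTT'_hamiltonian_dWave :
    (dWaveZ2SystemTT' L t' U μ dWaveFormFactor).hamiltonian = dWaveSourceTorusTT' L t' U μ 0 := by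
  rw [← KomaTasaki.Z2System.fieldHamiltonian_zero, dWaveZ2SystemTT'_fieldHamiltonian_dWave]

/-- **The field-induced order parameter of the instance is the sourced thermal pair amplitude**:
`m_Λ(B) = L⁻² · Re ⟨Δ_d + Δ_d†⟩_{β, dWaveSourceTorusTT' L t' U μ B}` (Gibbs state of the sourced `t–t'` torus).
[cite: KomaTasaki1993, §2 (2.9), (2.11)] -/
theorem dWaveZ2SystemTT'_magnetisation_dWave (β B : ℝ) :
    (dWaveZ2SystemTT' L t' U μ dWaveFormFactor).magnetisation β B =
      ((L : ℝ) ^ 2)⁻¹ * (gibbsState β (dWaveSourceTorusTT' L t' U μ B)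
        (pairField dWaveFormFactor L + (pairField dWaveFormFactor L)ᴴ)).re := by
  rw [KomaTasaki.Z2System.magnetisation, dWaveZ2SystemTT'_fieldHamiltonian_dWave, dWaveZ2SystemTT'_order,
    card_torusSite_two, Nat.cast_pow]

/-- **The zero-field moments of the instance are the thermal pair-LRO moments**:
`N^{-2k} ⟨O^{2k}⟩_Λ(0) = (L²)^{-2k} · Re ⟨(Δ_d + Δ_d†)^{2k}⟩_{β, dWaveSourceTorusTT' L t' U μ 0}`.
[cite: KomaTasaki1993, §2 (2.12)–(2.13)] -/
theorem dWaveZ2SystemTT'_moment_dWave (β : ℝ) (k : ℕ) :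
    (dWaveZ2SystemTT' L t' U μ dWaveFormFactor).moment β k =
      (((L : ℝ) ^ 2) ^ (2 * k))⁻¹ * (gibbsState β (dWaveSourceTorusTT' L t' U μ 0)
        ((pairField dWaveFormFactor L + (pairField dWaveFormFactor L)ᴴ) ^ (2 * k))).re := by
  rw [KomaTasaki.Z2System.moment, dWaveZ2SystemTT'_hamiltonian_dWave, dWaveZ2SystemTT'_order, card_torusSite_two,
    Nat.cast_pow]

end InstanceTT

/-! ### KT93 Theorem 2.1 for the pair-sourced Hubbard tori, by name -/

section ThermalTT

/-- **KOMA–TASAKI 1993 THEOREM 2.1 FOR THE PAIR-SOURCED `t–t'` HUBBARD TORI** (`T > 0`, every `β > 0`,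
every `t'`): for the sequence of systems `dWaveZ2SystemTT' (L+1) t' U μ g` (tori `(ℤ/(L+1)ℤ)²`), under KT's
hypothesis i) — for every field `B` the free energies per site
`f_L(B) = −(β|Λ_L|)⁻¹ log Tr e^{−β(H^{tt'} − μN − B(Δ_g+Δ_g†))}` converge as `L → ∞` — one has, for every
`k ≥ 1`, `B > 0`, `ε > 0`, eventually in `L, L'`:
`(|Λ_{L'}|^{-2k} ⟨(Δ_g+Δ_g†)^{2k}⟩_{β,0,L'})^{1/(2k)} ≤ |Λ_L|⁻¹ ⟨Δ_g+Δ_g†⟩_{β,B,L} + ε`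
— thermal pair long-range order of the symmetric Gibbs states forces a sourced thermal pair amplitude
(volume limit first, then `B ↓ 0`). Instance of the tree's `kt93_theorem_2_1_holds`; the `t' ≠ 0` twin of
`dWave_kt93_theorem_2_1`.
[cite: KomaTasaki1993, §2 Theorem 2.1 (2.13)] -/
theorem dWave_kt93_theorem_2_1_TT' (t' U μ : ℝ) (g : Site 2 → ℝ) {β : ℝ} (hβ : 0 < β)
    (hlim : ∀ B : ℝ, ∃ f : ℝ,
      Tendsto (fun L : ℕ => (dWaveZ2SystemTT' (L + 1) t' U μ g).freeEnergy β B) atTop (𝓝 f))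
    {k : ℕ} (hk : 1 ≤ k) {B : ℝ} (hB : 0 < B) {ε : ℝ} (hε : 0 < ε) :
    ∃ L₀ : ℕ, ∀ L L' : ℕ, L₀ ≤ L → L₀ ≤ L' →
      ((dWaveZ2SystemTT' (L' + 1) t' U μ g).moment β k) ^ ((1 : ℝ) / (2 * k)) ≤
        (dWaveZ2SystemTT' (L + 1) t' U μ g).magnetisation β B + ε :=
  KomaTasaki.kt93_theorem_2_1_holds _ _ _ (fun L => Fintype.card (TorusSite 2 (L + 1)))
    (fun L => FockIdx (L + 1)) (fun L => dWaveZ2SystemTT' (L + 1) t' U μ g) β hβ tendsto_card_torusSite_succ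
    hlim k hk B hB ε hε

/-- **THERMAL `d`-WAVE PAIR LRO FORCES THE SOURCED THERMAL PAIR AMPLITUDE AT EVERY `t'`** (`k = 1`,
`d`-wave, torus vocabulary): under hypothesis i) for the Gibbs free energies of
`dWaveSourceTorusTT' (L+1) t' U μ B`, for every `B > 0`, `ε > 0`, eventually in `L, L'`:
`√( ((L'+1)²)⁻² · Re⟨(Δ_d+Δ_d†)²⟩_{β, dWaveSourceTorusTT' (L'+1) t' U μ 0} )
   ≤ ((L+1)²)⁻¹ · Re⟨Δ_d+Δ_d†⟩_{β, dWaveSourceTorusTT' (L+1) t' U μ B} + ε`.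
The `t' ≠ 0` twin of `dWave_thermal_pairLRO_le_sourcedPairAmplitude` (direction LRO ⇒ response only;
constant `1`). [cite: KomaTasaki1993, §2 Theorem 2.1 (2.13), k = 1] -/
theorem dWave_thermal_pairLRO_le_sourcedPairAmplitude_TT' (t' U μ : ℝ) {β : ℝ} (hβ : 0 < β)
    (hlim : ∀ B : ℝ, ∃ f : ℝ,
      Tendsto (fun L : ℕ => (dWaveZ2SystemTT' (L + 1) t' U μ dWaveFormFactor).freeEnergy β B) atTop (𝓝 f))
    {B : ℝ} (hB : 0 < B) {ε : ℝ} (hε : 0 < ε) :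
    ∃ L₀ : ℕ, ∀ L L' : ℕ, L₀ ≤ L → L₀ ≤ L' →
      Real.sqrt (((((L' + 1 : ℕ) : ℝ) ^ 2) ^ 2)⁻¹ *
          (gibbsState β (dWaveSourceTorusTT' (L' + 1) t' U μ 0)
            ((pairField dWaveFormFactor (L' + 1) + (pairField dWaveFormFactor (L' + 1))ᴴ) ^ 2)).re) ≤
        ((((L + 1 : ℕ) : ℝ) ^ 2))⁻¹ * (gibbsState β (dWaveSourceTorusTT' (L + 1) t' U μ B)
          (pairField dWaveFormFactor (L + 1) + (pairField dWaveFormFactor (L + 1))ᴴ)).re + ε := by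
  obtain ⟨L₀, hL₀⟩ := dWave_kt93_theorem_2_1_TT' t' U μ dWaveFormFactor hβ hlim (le_refl 1) hB hε
  refine ⟨L₀, fun L L' hL hL' => ?_⟩
  have h := hL₀ L L' hL hL'
  rw [dWaveZ2SystemTT'_moment_dWave, dWaveZ2SystemTT'_magnetisation_dWave] at h
  rw [Real.sqrt_eq_rpow]
  convert h using 2
  norm_num

/-- **The free energy per site of the `d`-wave `t–t'` system is the sourced torus pressure** (up to sign):
`f_{L}(B) = −log Re Z_β(dWaveSourceTorusTT' L t' U μ B) / (β L²)`. [cite: KomaTasaki1993, §2 (2.8)] -/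
theorem dWaveZ2SystemTT'_freeEnergy_dWave (L : ℕ) [NeZero L] (t' U μ β B : ℝ) :
    (dWaveZ2SystemTT' L t' U μ dWaveFormFactor).freeEnergy β B =
      -(Real.log (partitionFn β (dWaveSourceTorusTT' L t' U μ B)).re / (β * (L : ℝ) ^ 2)) := by
  rw [KomaTasaki.Z2System.freeEnergy, dWaveZ2SystemTT'_fieldHamiltonian_dWave, card_torusSite_two, Nat.cast_pow,
    div_eq_inv_mul, neg_mul]

/-- **Hypothesis i) from a sourced-pressure limit in `ε–L₀` form.** If for every source `h` the sourced
`t–t'` torus pressure `log Re Z_β(dWaveSourceTorusTT' L t' U μ h)/(βL²)` converges as `L → ∞` (stated as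
`∃ q, ∀ κ > 0, ∃ L₀, ∀ L ≥ L₀, |… − q| ≤ κ`), then KT's hypothesis i) holds for the systems
`dWaveZ2SystemTT' (L+1) t' U μ d`. [cite: KomaTasaki1993, §2 i) (2.10)] -/
theorem dWaveZ2SystemTT'_freeEnergy_tendsto_of_pressureLimit (t' U μ β : ℝ)
    (hq : ∀ h : ℝ, ∃ q : ℝ, ∀ κ : ℝ, 0 < κ → ∃ L₀ : ℕ, ∀ (L : ℕ) [NeZero L], L₀ ≤ L →
      |Real.log (partitionFn β (dWaveSourceTorusTT' L t' U μ h)).re / (β * (L : ℝ) ^ 2) - q| ≤ κ) (B : ℝ) :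
    ∃ f : ℝ, Tendsto (fun L : ℕ => (dWaveZ2SystemTT' (L + 1) t' U μ dWaveFormFactor).freeEnergy β B) atTop (𝓝 f) := by
  obtain ⟨q, hqB⟩ := hq B
  refine ⟨-q, Metric.tendsto_atTop.2 fun κ hκ => ?_⟩
  obtain ⟨L₀, hL₀⟩ := hqB (κ / 2) (half_pos hκ)
  refine ⟨L₀, fun L hL => ?_⟩
  have h := hL₀ (L + 1) (by omega)
  rw [dWaveZ2SystemTT'_freeEnergy_dWave, Real.dist_eq, Nat.cast_succ]
  rw [Nat.cast_succ] at h
  rw [show -(Real.log (partitionFn β (dWaveSourceTorusTT' (L + 1) t' U μ B)).re / (β * ((L : ℝ) + 1) ^ 2)) - -q =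
      -(Real.log (partitionFn β (dWaveSourceTorusTT' (L + 1) t' U μ B)).re / (β * ((L : ℝ) + 1) ^ 2) - q) by ring,
    abs_neg]
  linarith

/-- **THERMAL `d`-WAVE PAIR LRO FORCES THE SOURCED THERMAL PAIR AMPLITUDE AT EVERY `t'` — from a
sourced-pressure limit.** As `dWave_thermal_pairLRO_le_sourcedPairAmplitude_TT'`, with hypothesis i) replaced
by the `ε–L₀` pressure-limit statement
`∀ h, ∃ q, ∀ κ > 0, ∃ L₀, ∀ L ≥ L₀, |log Re Z_β(dWaveSourceTorusTT' L t' U μ h)/(βL²) − q| ≤ κ`.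
[cite: KomaTasaki1993, §2 Theorem 2.1 (2.13)] -/
theorem dWave_thermal_pairLRO_le_sourcedPairAmplitude_TT'_of_pressureLimit (t' U μ : ℝ) {β : ℝ} (hβ : 0 < β)
    (hq : ∀ h : ℝ, ∃ q : ℝ, ∀ κ : ℝ, 0 < κ → ∃ L₀ : ℕ, ∀ (L : ℕ) [NeZero L], L₀ ≤ L →
      |Real.log (partitionFn β (dWaveSourceTorusTT' L t' U μ h)).re / (β * (L : ℝ) ^ 2) - q| ≤ κ)
    {B : ℝ} (hB : 0 < B) {ε : ℝ} (hε : 0 < ε) :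
    ∃ L₀ : ℕ, ∀ L L' : ℕ, L₀ ≤ L → L₀ ≤ L' →
      Real.sqrt (((((L' + 1 : ℕ) : ℝ) ^ 2) ^ 2)⁻¹ *
          (gibbsState β (dWaveSourceTorusTT' (L' + 1) t' U μ 0)
            ((pairField dWaveFormFactor (L' + 1) + (pairField dWaveFormFactor (L' + 1))ᴴ) ^ 2)).re) ≤
        ((((L + 1 : ℕ) : ℝ) ^ 2))⁻¹ * (gibbsState β (dWaveSourceTorusTT' (L + 1) t' U μ B)
          (pairField dWaveFormFactor (L + 1) + (pairField dWaveFormFactor (L + 1))ᴴ)).re + ε :=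
  dWave_thermal_pairLRO_le_sourcedPairAmplitude_TT' t' U μ hβ
    (dWaveZ2SystemTT'_freeEnergy_tendsto_of_pressureLimit t' U μ β hq) hB hε

end ThermalTT

/-! ### The `U(1)` factor `√2` (KT93 Remark after Theorem 6.1, `Z2System.kt93_corollary_2_2_u1`) at every `t'` -/

section SqrtTwoTT

variable (t' U μ : ℝ) (g : Site 2 → ℝ)

/-- **KOMA–TASAKI 1993, COROLLARY 2.2 WITH THE `U(1)` FACTOR `√2`, FOR THE PAIR-SOURCED `t–t'` HUBBARD TORI**
(`T > 0`, every `t'`): under hypothesis i) for the systems `dWaveZ2SystemTT' (L+1) t' U μ g`, for every `B > 0`,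
`ε' > 0`, eventually in `L, L'`: `√2 · (|Λ_{L'}|⁻² ⟨(Δ_g+Δ_g†)²⟩_{β,0,L'})^{1/2} ≤ |Λ_L|⁻¹ ⟨Δ_g+Δ_g†⟩_{β,B,L} + ε'`.
Instance of `Z2System.kt93_corollary_2_2_u1` with `O^{(2)} = i(Δ_g−Δ_g†)`, `C = N̂` (which commutes with
`hubbardTorusTT' − μN`), `ε = −2i`, `κ = 50`; the `t' ≠ 0` twin of `dWave_kt93_corollary_2_2_u1`.
[cite: KomaTasaki1993, Corollary 2.2 (2.18) with Remark after Theorem 6.1 (U(1): factor √2)] -/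
theorem dWave_kt93_corollary_2_2_u1_TT' (hg : 0 < pairNormConst g) {β : ℝ} (hβ : 0 < β)
    (hlim : ∀ B : ℝ, ∃ f : ℝ,
      Tendsto (fun L : ℕ => (dWaveZ2SystemTT' (L + 1) t' U μ g).freeEnergy β B) atTop (𝓝 f))
    {B : ℝ} (hB : 0 < B) {ε' : ℝ} (hε' : 0 < ε') :
    ∃ L₀ : ℕ, ∀ L L' : ℕ, L₀ ≤ L → L₀ ≤ L' →
      Real.sqrt 2 * Real.sqrt ((dWaveZ2SystemTT' (L' + 1) t' U μ g).moment β 1) ≤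
        (dWaveZ2SystemTT' (L + 1) t' U μ g).magnetisation β B + ε' := by
  refine KomaTasaki.Z2System.kt93_corollary_2_2_u1 (fun L => dWaveZ2SystemTT' (L + 1) t' U μ g)
    (fun L => I • (pairField g (L + 1) - (pairField g (L + 1))ᴴ)) (fun L => totalNumber)
    (ε := -2 * I) (κ := 50) ?_ (by norm_num) (fun L => isHermitian_I_smul_pairField_sub (L + 1) g) ?_ ?_ ?_
    ?_ ?_ hβ tendsto_card_torusSite_succ hlim B hB ε' hε'
  · exact mul_ne_zero (by norm_num) Complex.I_ne_zero
  · intro L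
    rw [dWaveZ2SystemTT'_hamiltonian]
    exact (hubbardTorusTT'_commute_totalNumber (L + 1) 1 t' U).sub_left
      ((Commute.refl totalNumber).smul_left (μ : ℂ))
  · intro L
    rw [dWaveZ2SystemTT'_order]
    exact totalNumber_comm_I_smul_pairField_sub (L + 1) g
  · intro L
    rw [dWaveZ2SystemTT'_order]
    exact totalNumber_comm_pairField_add (L + 1) g
  · intro L
    exact norm_I_smul_pairField_sub_le (L + 1) g
  · intro L
    rw [dWaveZ2SystemTT'_order]
    exact norm_comm_orderTwo_orderOne_le (L + 1) g hg

/-- **THERMAL `d`-WAVE PAIR LRO FORCES THE SOURCED THERMAL PAIR AMPLITUDE AT EVERY `t'`, WITH THE SHARP `U(1)`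
FACTOR `√2`** (torus vocabulary, `d`-wave): under hypothesis i), for every `B > 0`, `ε > 0`, eventually in
`L, L'`:
`√2 · √( ((L'+1)²)⁻² · Re⟨(Δ_d+Δ_d†)²⟩_{β, dWaveSourceTorusTT' (L'+1) t' U μ 0} )
   ≤ ((L+1)²)⁻¹ · Re⟨Δ_d+Δ_d†⟩_{β, dWaveSourceTorusTT' (L+1) t' U μ B} + ε` — the thermal twin of the
`T = 0` `√2`-sharp `le_dWaveOrderParameterTT'_of_pairLRO`.
[cite: KomaTasaki1993, Corollary 2.2 (2.18) with Remark after Theorem 6.1 (U(1): factor √2)] -/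
theorem dWave_thermal_pairLRO_le_sourcedPairAmplitude_TT'_sqrtTwo (t' U μ : ℝ) {β : ℝ} (hβ : 0 < β)
    (hlim : ∀ B : ℝ, ∃ f : ℝ,
      Tendsto (fun L : ℕ => (dWaveZ2SystemTT' (L + 1) t' U μ dWaveFormFactor).freeEnergy β B) atTop (𝓝 f))
    {B : ℝ} (hB : 0 < B) {ε : ℝ} (hε : 0 < ε) :
    ∃ L₀ : ℕ, ∀ L L' : ℕ, L₀ ≤ L → L₀ ≤ L' →
      Real.sqrt 2 * Real.sqrt (((((L' + 1 : ℕ) : ℝ) ^ 2) ^ 2)⁻¹ *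
          (gibbsState β (dWaveSourceTorusTT' (L' + 1) t' U μ 0)
            ((pairField dWaveFormFactor (L' + 1) + (pairField dWaveFormFactor (L' + 1))ᴴ) ^ 2)).re) ≤
        ((((L + 1 : ℕ) : ℝ) ^ 2))⁻¹ * (gibbsState β (dWaveSourceTorusTT' (L + 1) t' U μ B)
          (pairField dWaveFormFactor (L + 1) + (pairField dWaveFormFactor (L + 1))ᴴ)).re + ε := by
  obtain ⟨L₀, hL₀⟩ :=
    dWave_kt93_corollary_2_2_u1_TT' t' U μ dWaveFormFactor pairNormConst_dWave_pos hβ hlim hB hε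
  refine ⟨L₀, fun L L' hL hL' => ?_⟩
  have h := hL₀ L L' hL hL'
  rw [dWaveZ2SystemTT'_moment_dWave, dWaveZ2SystemTT'_magnetisation_dWave] at h
  convert h using 3

/-- The `√2`-sharp thermal inequality at every `t'` from a sourced-pressure limit in `ε–L₀` form.
[cite: KomaTasaki1993, Corollary 2.2 (2.18) with Remark after Theorem 6.1 (U(1): factor √2)] -/
theorem dWave_thermal_pairLRO_le_sourcedPairAmplitude_TT'_sqrtTwo_of_pressureLimit (t' U μ : ℝ) {β : ℝ}
    (hβ : 0 < β)
    (hq : ∀ h : ℝ, ∃ q : ℝ, ∀ κ : ℝ, 0 < κ → ∃ L₀ : ℕ, ∀ (L : ℕ) [NeZero L], L₀ ≤ L →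
      |Real.log (partitionFn β (dWaveSourceTorusTT' L t' U μ h)).re / (β * (L : ℝ) ^ 2) - q| ≤ κ)
    {B : ℝ} (hB : 0 < B) {ε : ℝ} (hε : 0 < ε) :
    ∃ L₀ : ℕ, ∀ L L' : ℕ, L₀ ≤ L → L₀ ≤ L' →
      Real.sqrt 2 * Real.sqrt (((((L' + 1 : ℕ) : ℝ) ^ 2) ^ 2)⁻¹ *
          (gibbsState β (dWaveSourceTorusTT' (L' + 1) t' U μ 0)
            ((pairField dWaveFormFactor (L' + 1) + (pairField dWaveFormFactor (L' + 1))ᴴ) ^ 2)).re) ≤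
        ((((L + 1 : ℕ) : ℝ) ^ 2))⁻¹ * (gibbsState β (dWaveSourceTorusTT' (L + 1) t' U μ B)
          (pairField dWaveFormFactor (L + 1) + (pairField dWaveFormFactor (L + 1))ᴴ)).re + ε :=
  dWave_thermal_pairLRO_le_sourcedPairAmplitude_TT'_sqrtTwo t' U μ hβ
    (dWaveZ2SystemTT'_freeEnergy_tendsto_of_pressureLimit t' U μ β hq) hB hε

end SqrtTwoTT

end Literature.MathematicalPhysics.QuantumLattice

end
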